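import Mathlib
import HarnessLib

/-!
# Mittag-Leffler input of the `Λ`-adic road to SURJ⁺@2 (item 23110 at every rank): a cofiltered system of FINITE non-empty sets with
# at most one compatible family has EVENTUALLY CONSTANT transition maps — pure category theory over Mathlib's `CofilteredSystem`

Routes `ResidualThetaTransportAtTwo` (RTT, crux r201 `ResidualLambdaFormulaNegDiscAtTwo`, stmt-BirchSwinnertonDyer-23110) /
`ThetaPartnerAtTwo` (K1 `stub_surj2`). Seat `prover-bsd-rtt-w4` (width w4 of keying brief (195)); `--supports stmt-BirchSwinnertonDyer-23110`.
THEOREMS ONLY (no definition, no named fact, no `sorry`); pure Mathlib.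

WHY (memo ALL-RANK-RLF-ROADS-w4g0 §4). Once the universal-norm compact `+` Selmer group vanishes (`𝔖⁺_∞ = 0`: tower-vanishing lemma
p645112 + (Λ2) p645404 + (Λ3) p645699 + Kato's torsion-free `𝐇¹`), SURJ⁺@2 follows from Poitou–Tate at ONE finite layer provided the
vanishing of the LIMIT is converted into the vanishing of ONE transition map `cor ∘ red : Sel⁺(ℚ_m, E[2^K]) → Sel⁺(ℚ_n, E[2^k])` of the
inverse system of FINITE groups — the Mittag-Leffler / Kőnig step. THIS FILE proves that step abstractly:

* `eventualRange_subsingleton_of_subsingleton_sections` — for a functor `F : J ⥤ Type` on a cofiltered category with finite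
  non-empty values and at most one section, every eventual range is a subsingleton (the restriction of `F` to its eventual ranges has
  surjective transition maps, so every eventual element extends to a section: Mathlib's `eval_section_surjective_of_surjective`);
* `exists_range_subsingleton_of_subsingleton_sections` — hence for every `j` there are `i` and `f : i ⟶ j` with `F.map f` CONSTANT
  (the eventual range is attained: `isMittagLeffler_of_exists_finite_range`);
* `exists_map_eq_map_of_subsingleton_sections` — the same in element form: `F.map f x = F.map f y` for all `x, y`.

For the tower of finite signed Selmer groups (zero is a compatible family, and it is the only one iff `𝔖⁺_∞ = 0`) this says: every
layer-`n` group receives the ZERO map from some higher layer. HONEST FRAMING: closes nothing; BSD is not proved by any of this.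
References: [NeukirchSchmidtWingberg2008] Ch. I §1 / Ch. IV (inverse limits of finite groups, Mittag-Leffler);
[GreenbergVatsal2000] §2 Prop. (2.1).
-/

set_option autoImplicit false
-- D-0017: single-problem summit, so `Summit.BirchSwinnertonDyer.BirchSwinnertonDyer.…` repeats a namespace BY DESIGN.
set_option linter.dupNamespace false

universe v u

namespace Summit.BirchSwinnertonDyer.BirchSwinnertonDyer.Theorems.ResidualThetaLayer.TowerVanishing

open CategoryTheory CategoryTheory.Functor Set

variable {J : Type u} [Category J] [IsCofilteredOrEmpty J] (F : J ⥤ Type v)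
  [∀ j, Nonempty (F.obj j)] [∀ j, Finite (F.obj j)]

/-- **At most one section ⇒ every eventual range is a subsingleton** (finite non-empty cofiltered system). The restriction of `F` to
its eventual ranges is Mittag-Leffler with surjective transition maps and non-empty finite values, so evaluation of sections at `j` is
onto the eventual range (`eval_section_surjective_of_surjective`); its sections are those of `F` (`toEventualRangesSectionsEquiv`).
[cite: NeukirchSchmidtWingberg2008, Ch. IV §2 (projective limits of finite sets)] -/
theorem eventualRange_subsingleton_of_subsingleton_sections [Subsingleton F.sections] (j : J) :
    (F.eventualRange j).Subsingleton := by
  have hML : F.IsMittagLeffler := F.isMittagLeffler_of_exists_finite_range fun j ↦ ⟨j, 𝟙 j, Set.toFinite _⟩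
  haveI : ∀ j, Nonempty (F.toEventualRanges.obj j) := fun j ↦ F.toEventualRanges_nonempty hML j
  have hsurj := F.toEventualRanges.eval_section_surjective_of_surjective (F.surjective_toEventualRanges hML) j
  intro x hx y hy
  obtain ⟨sx, hsx⟩ := hsurj ⟨x, hx⟩
  obtain ⟨sy, hsy⟩ := hsurj ⟨y, hy⟩
  have hs : sx = sy := F.toEventualRangesSectionsEquiv.injective (Subsingleton.elim _ _)
  subst hs
  have h := hsx.symm.trans hsy
  exact congrArg Subtype.val h

/-- **At most one section ⇒ some transition map into `j` has subsingleton range** (the eventual range is attained at a finite stage).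
[cite: NeukirchSchmidtWingberg2008, Ch. IV §2 (projective limits of finite sets)] -/
theorem exists_range_subsingleton_of_subsingleton_sections [Subsingleton F.sections] (j : J) :
    ∃ (i : J) (f : i ⟶ j), (Set.range (F.map f)).Subsingleton := by
  have hML : F.IsMittagLeffler := F.isMittagLeffler_of_exists_finite_range fun j ↦ ⟨j, 𝟙 j, Set.toFinite _⟩
  obtain ⟨i, f, hif⟩ := F.isMittagLeffler_iff_eventualRange.1 hML j
  refine ⟨i, f, ?_⟩
  rw [← hif]
  exact eventualRange_subsingleton_of_subsingleton_sections F j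

/-- **Element form**: with at most one section, every index `j` receives a CONSTANT transition map `F.map f`, `f : i ⟶ j`.
For an inverse system of finite (additive) groups whose only compatible family is `0`, this is «`F.map f = 0` for some `i`».
[cite: NeukirchSchmidtWingberg2008, Ch. IV §2 (projective limits of finite sets)] -/
theorem exists_map_eq_map_of_subsingleton_sections [Subsingleton F.sections] (j : J) :
    ∃ (i : J) (f : i ⟶ j), ∀ x y : F.obj i, F.map f x = F.map f y := by
  obtain ⟨i, f, h⟩ := exists_range_subsingleton_of_subsingleton_sections F j
  exact ⟨i, f, fun x y ↦ h ⟨x, rfl⟩ ⟨y, rfl⟩⟩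

end Summit.BirchSwinnertonDyer.BirchSwinnertonDyer.Theorems.ResidualThetaLayer.TowerVanishing
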